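import Summits.NavierStokesRegularity.FluidComputer.PalasekTowerRegisterGlobalCoreFloorsAt
import Summits.NavierStokesRegularity.FluidComputer.PalasekTowerRegisterGlobalEnvelopeAtHolds
import Summits.NavierStokesRegularity.FluidComputer.PalasekTowerHeredityWitnessCalibration

/-!
# REGISTER v2.3′: readout properties AT level `k` — the lower half `ReadoutFloorsAt k` split into its
# three floors (`SpeedFloorAt k ∧ StrainFloorAt k ∧ CoreFloorAt k`), losslessly, and the transfer calculus

Cell `ns-blowup`, seat `ns-palasek-19249-p2` (prover; D-0081 §C stub-worker on the registered birth line
`Cruxes/HeredityAtOne/Lines/birth.lean` v2 b90ab6bc703b9c77 of item stmt-NavierStokesRegularity-19249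
`HeredityAtOne`, stub `stub_readout_floors_one : ReadoutFloorsAt 1`; the item is supported, NOT closed or
claimed). Companion of `PalasekTowerRegisterGlobalHalvesAt.lean` (ecbridge-7, p422702: `ReadoutFloorsAt k`,
`ReadoutFloorsAt.of_exists`), `PalasekTowerRegisterGlobalCoreFloorsAt.lean` (ecbridge-5 g3, p432285: the core
conjunct carries weak speed / strain floors), `PalasekTowerRegisterGlobalEnvelopeAtHolds.lean` (ecbridge-7 g3,
p442648: `HeredityAtOne ↔ AprioriCeilingAt 1 ∧ ReadoutFloorsAt 1`) and `PalasekTowerRescaledCopy.lean`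
(fc-prover-3, p422042: `Runs` / `Letter`). LABEL: E–C typing (KERNEL: one predicate schema, three
level-indexed `@[conjecture]` predicates = the three conjuncts of the lower half of record at a fixed
level, nothing new is asserted; and PROVED equivalences / transfers). WHAT THIS IS NOT: not Navier–Stokes
evidence — no stage, flow or tower is constructed or claimed; `SpeedFloorAt k`, `StrainFloorAt k`,
`CoreFloorAt k` are OPEN statements appearing only inside equivalences / implications.

## What is typed and proved

* §1 `ReadoutAt k P` — the SCHEMA «every finite-energy classical continuation, inside the next ceiling
  `c₂ Y_{k+1}`, of every globally anchored registered level-`k` stage of a pinned (`Λ = 8`, `θ = 6/5`),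
  rigid, quiet wide design has property `P S (u (τ (k+1)))` at the readout» (the common quantifier
  prefix of `ReadoutFloorsAt k`, with the conclusion abstracted to a predicate of the schedule and the
  time-slice). Calculus: `ReadoutAt.mono`, `ReadoutAt.and_iff`, and the TRANSFER
  `ReadoutAt.of_exists` — ONE continuation per stage with property `P` gives `ReadoutAt k P` (all tame
  continuations share their velocity, `Stage.velocity_eq_of_window_ceiling`, forced Serrin–Masuda, no
  W14); under the upper half the converse holds (`ReadoutAt.iff_exists`).
* §2 the three floors AT level `k`: `SpeedFloorAt k` (speed `≥ c₁ Y_{k+1}` somewhere in the ball at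
  `τ (k+1)`), `StrainFloorAt k` (gradient `≥ c₁ A_{k+1}` somewhere in the ball), `CoreFloorAt k` (a level
  `k+1` core loop: `C¹`, closed, in a ball of radius `1/N_{k+1}` centred in the tower's ball, speed
  `≤ 8π/N_{k+1}`, circulation `≥ c₁ N_{k+1}^{β-2}`); each is `ReadoutAt k` of the corresponding conjunct
  of `Letter S (k+1)` (`Iff.rfl`), and **`readoutFloorsAt_iff_floors :
  ReadoutFloorsAt k ↔ SpeedFloorAt k ∧ StrainFloorAt k ∧ CoreFloorAt k`** (LOSSLESS, definitional
  reshuffling; `readoutFloorsAt_iff_readoutAt_letter`).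
* §3 the item in FOUR physics conjuncts, no hypothesis: `heredityAt_iff_apriori_and_floors (1 ≤ k) :
  HeredityAt k ↔ AprioriCeilingAt k ∧ SpeedFloorAt k ∧ StrainFloorAt k ∧ CoreFloorAt k`; at the first rung
  **`heredityAtOne_iff_apriori_speed_strain_core`** (item 19249 = «no overshoot of `(5/3)·Y₂` before
  `τ₂`» ∧ «speed `≥ Y₂` in the ball at `τ₂`» ∧ «strain `≥ A₂` in the ball at `τ₂`» ∧ «an `N₂`-core at
  `τ₂`»); projections `HeredityAt.speedFloorAt` … ; the composition `heredityAtOne_of_apriori_floors`.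
* §4 what the core conjunct already pays: `CoreFloorAt.weak_floors` — `CoreFloorAt k` gives, on every
  tame continuation, speed `≥ c₁ Y_{k+1}/(8π)` and strain `≥ c₁ A_{k+1}/(8π)` within `radius + 1/N_{k+1}`
  at `τ (k+1)` (ecbridge-5's `readout_core_floors`); the registered speed / strain conjuncts exceed this
  by the factor `8π` inside the ball proper, so none of the three conjuncts is implied by the others
  through this kinematics.
* §5 arithmetic of the first hand-over (certified, wide rates, rigid constants): the level-2 SPEED floor
  is incompatible with the level-1 ceiling — `(5/3)·Y₁ < Y₂` (`speedFloor_two_gt_ceiling_one`), so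
  `SpeedFloorAt 1` asks of every tame continuation a point of the ball whose speed at `τ₂` STRICTLY
  exceeds every speed anywhere at `τ₁` (`SpeedFloorAt.exists_jump_one`: the jump is produced inside
  the window `(τ₁, τ₂]`, it cannot be inherited); the growth factor demanded is `Y₂/((5/3)Y₁) > 1.325`
  from the ceiling and `Y₂/Y₁ > 2.209` from the floor point.

References: S. Palasek, arXiv:2605.13827 §3.1, §4 [cite: Palasek2026ElementaryModel, §3–§4]; H. Sohr, *The
Navier–Stokes Equations*, Birkhäuser 2001, Ch. V Thm. 1.5.1 [cite: Sohr2001, Ch. V Thm. 1.5.1]; A. J. Majda,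
A. L. Bertozzi, *Vorticity and Incompressible Flow*, CUP 2002, §1.6 (1.57) [cite: MajdaBertozziCUP2002, §1.6].
-/

noncomputable section

namespace Summit.NavierStokesRegularity.FluidComputer.PalasekTowerClayBridge

open Set MeasureTheory Filter Topology Function Real
open scoped ENNReal ContDiff NNReal
open Literature.Analysis.FluidPDE
open Summit.NavierStokesRegularity.NavierStokesRegularity

/-! ## §1 The readout schema and its transfer calculus -/

/-- **READOUT SCHEMA AT level `k`.** For a predicate `P` of a wide schedule and a velocity slice:
every pinned (`Λ = 8`, `θ = 6/5`), rigid, quiet wide schedule `S`, every globally anchored registered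
stage `s` at level `k`, and every classical solution `(u, p)` of the design's system on `[0, τ (k+1)]`
agreeing with `s` on `[0, τ k]`, of finite energy, inside the next ceiling `c₂ Y_{k+1}` on
`[0, τ (k+1)] × ℝ³`, satisfy `P S (u (τ (k+1)))`. The quantifier prefix of the lower half
`ReadoutFloorsAt k` with its conclusion abstracted. [cite: Palasek2026ElementaryModel, §4] -/
def ReadoutAt (k : ℕ)
    (P : Schedule TowerRates.wide → (EuclideanSpace ℝ (Fin 3) → EuclideanSpace ℝ (Fin 3)) → Prop) :
    Prop :=
  ∀ S : Schedule TowerRates.wide, S.Pins 8 (6 / 5) → S.Rigid → S.Quiet →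
    ∀ s : Stage 1 TowerRates.wide S (Margins.routeG TowerRates.wide) k,
    ∀ (u : ℝ → EuclideanSpace ℝ (Fin 3) → EuclideanSpace ℝ (Fin 3))
      (p : ℝ → EuclideanSpace ℝ (Fin 3) → ℝ),
      IsClassicalNSSolutionOn (Icc 0 (S.τ (k + 1))) 1 S.f u p →
      (∀ t ∈ Icc 0 (S.τ k), u t = s.u t ∧ p t = s.p t) →
      (∃ C : ℝ≥0∞, C < ⊤ ∧ ∀ t ∈ Icc 0 (S.τ (k + 1)), ∫⁻ x, ‖u t x‖ₑ ^ 2 ≤ C) →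
      (∀ t ∈ Icc 0 (S.τ (k + 1)), ∀ x, ‖u t x‖ ≤ S.c₂ * TowerRates.wide.Y (k + 1)) →
      P S (u (S.τ (k + 1)))

namespace ReadoutAt

variable {k : ℕ}
  {P Q : Schedule TowerRates.wide → (EuclideanSpace ℝ (Fin 3) → EuclideanSpace ℝ (Fin 3)) → Prop}

/-- The schema is monotone in the predicate. [folklore] -/
theorem mono (hPQ : ∀ S v, P S v → Q S v) (h : ReadoutAt k P) : ReadoutAt k Q :=
  fun S hP hR hQ s u p hcl hagree hE hceil => hPQ S _ (h S hP hR hQ s u p hcl hagree hE hceil)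

/-- The schema commutes with conjunction. [folklore] -/
theorem and_iff : ReadoutAt k (fun S v => P S v ∧ Q S v) ↔ ReadoutAt k P ∧ ReadoutAt k Q :=
  ⟨fun h => ⟨h.mono fun _ _ h' => h'.1, h.mono fun _ _ h' => h'.2⟩,
    fun h S hP hR hQ s u p hcl hagree hE hceil =>
      ⟨h.1 S hP hR hQ s u p hcl hagree hE hceil, h.2 S hP hR hQ s u p hcl hagree hE hceil⟩⟩

/-- The schema in the `Runs` vocabulary of line `fc-oneshot` (currying only). [folklore] -/
theorem iff_runs :
    ReadoutAt k P ↔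
      ∀ S : Schedule TowerRates.wide, S.Pins 8 (6 / 5) → S.Rigid → S.Quiet →
        ∀ s : Stage 1 TowerRates.wide S (Margins.routeG TowerRates.wide) k,
        ∀ (u : ℝ → EuclideanSpace ℝ (Fin 3) → EuclideanSpace ℝ (Fin 3))
          (p : ℝ → EuclideanSpace ℝ (Fin 3) → ℝ), Runs S k s u p → P S (u (S.τ (k + 1))) :=
  ⟨fun h S hP hR hQ s u p hr => h S hP hR hQ s u p hr.1 hr.2.1 hr.2.2.1 hr.2.2.2,
    fun h S hP hR hQ s u p h₁ h₂ h₃ h₄ => h S hP hR hQ s u p ⟨h₁, h₂, h₃, h₄⟩⟩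

/-- **TRANSFER — one continuation per stage suffices.** If every registered level-`k` stage of a
pinned rigid quiet wide design has SOME finite-energy classical solution `(v, q)` of the design's system
on `[0, τ (k+1)]`, agreeing with the stage IN VELOCITY on `[0, τ k]`, inside the ceiling `c₂ Y_{k+1}` and
with property `P` at `τ (k+1)`, then `ReadoutAt k P`: any other tame continuation has the same velocity on
`[0, τ (k+1)]` (`Stage.velocity_eq_of_window_ceiling` — the ceiling makes both the bounded = strong
solution; forced Serrin–Masuda, no W14). [cite: Sohr2001, Ch. V Thm. 1.5.1] -/
theorem of_exists
    (h : ∀ S : Schedule TowerRates.wide, S.Pins 8 (6 / 5) → S.Rigid → S.Quiet →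
      ∀ s : Stage 1 TowerRates.wide S (Margins.routeG TowerRates.wide) k,
        ∃ (v : ℝ → EuclideanSpace ℝ (Fin 3) → EuclideanSpace ℝ (Fin 3))
          (q : ℝ → EuclideanSpace ℝ (Fin 3) → ℝ),
          IsClassicalNSSolutionOn (Icc 0 (S.τ (k + 1))) 1 S.f v q ∧
          (∀ t ∈ Icc 0 (S.τ k), v t = s.u t) ∧
          (∃ C : ℝ≥0∞, C < ⊤ ∧ ∀ t ∈ Icc 0 (S.τ (k + 1)), ∫⁻ x, ‖v t x‖ₑ ^ 2 ≤ C) ∧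
          (∀ t ∈ Icc 0 (S.τ (k + 1)), ∀ x, ‖v t x‖ ≤ S.c₂ * TowerRates.wide.Y (k + 1)) ∧
          P S (v (S.τ (k + 1)))) :
    ReadoutAt k P := by
  intro S hP hR hQ s u p hcl hagree henergy hceil
  obtain ⟨v, q, hvcl, hvagree, hvenergy, hvceil, hPv⟩ := h S hP hR hQ s
  have h0 : (0 : ℝ) ∈ Icc 0 (S.τ k) := ⟨le_rfl, (S.τ_pos k).le⟩
  have hu0 : u 0 = S.u₀ := ((hagree 0 h0).1).trans s.initial
  have hv0 : v 0 = S.u₀ := (hvagree 0 h0).trans s.initial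
  have heq : ∀ t ∈ Icc 0 (S.τ (k + 1)), u t = v t :=
    s.velocity_eq_of_window_ceiling one_pos hvcl hv0 hvenergy (fun t ht x => hvceil t
      ⟨(S.τ_pos k).le.trans ht.1, ht.2⟩ x) hcl hu0 henergy
  have hτ : S.τ (k + 1) ∈ Icc 0 (S.τ (k + 1)) := ⟨(S.τ_pos (k + 1)).le, le_rfl⟩
  rw [heq (S.τ (k + 1)) hτ]
  exact hPv

/-- **Under the upper half the schema IS an `∃`-statement**: given `ContinuationEnvelopeAt k` (every
registered level-`k` stage has a tame continuation), `ReadoutAt k P` holds iff every registered level-`k`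
stage has a tame continuation (velocity agreement) with property `P` at `τ (k+1)`. [cite: Sohr2001, Ch. V Thm. 1.5.1] -/
theorem iff_exists (hE : ContinuationEnvelopeAt k) :
    ReadoutAt k P ↔
      ∀ S : Schedule TowerRates.wide, S.Pins 8 (6 / 5) → S.Rigid → S.Quiet →
        ∀ s : Stage 1 TowerRates.wide S (Margins.routeG TowerRates.wide) k,
          ∃ (v : ℝ → EuclideanSpace ℝ (Fin 3) → EuclideanSpace ℝ (Fin 3))
            (q : ℝ → EuclideanSpace ℝ (Fin 3) → ℝ),
            IsClassicalNSSolutionOn (Icc 0 (S.τ (k + 1))) 1 S.f v q ∧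
            (∀ t ∈ Icc 0 (S.τ k), v t = s.u t) ∧
            (∃ C : ℝ≥0∞, C < ⊤ ∧ ∀ t ∈ Icc 0 (S.τ (k + 1)), ∫⁻ x, ‖v t x‖ₑ ^ 2 ≤ C) ∧
            (∀ t ∈ Icc 0 (S.τ (k + 1)), ∀ x, ‖v t x‖ ≤ S.c₂ * TowerRates.wide.Y (k + 1)) ∧
            P S (v (S.τ (k + 1))) := by
  refine ⟨fun h S hP hR hQ s => ?_, of_exists⟩
  obtain ⟨u, p, hcl, hagree, henergy, hceil⟩ := hE S hP hR hQ s
  exact ⟨u, p, hcl, fun t ht => (hagree t ht).1, henergy, hceil,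
    h S hP hR hQ s u p hcl hagree henergy hceil⟩

end ReadoutAt

/-- The lower half at level `k` IS the schema read with the level-`(k+1)` letter. [folklore] -/
theorem readoutFloorsAt_iff_readoutAt_letter {k : ℕ} :
    ReadoutFloorsAt k ↔ ReadoutAt k (fun S v => Letter S (k + 1) v) :=
  Iff.rfl

/-! ## §2 The three floors AT level `k` -/

/-- **SPEED FLOOR AT level `k`** (open; never asserted): every tame continuation of every globally
anchored registered level-`k` stage of a pinned rigid quiet wide design carries, at `τ (k+1)`, speed
`≥ c₁ Y_{k+1}` at some point of the ball `‖x‖ ≤ radius`. At `k = 1`: speed `≥ Y₂ ≈ 6.1·10³` somewhere in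
the ball at `τ₂` — the JUMP of the hand-over `1 → 2` (`(5/3)·Y₁ < Y₂`: not inheritable from `τ₁`). The
first conjunct of the lower half of record `ReadoutFloorsAt k`. [cite: Palasek2026ElementaryModel, §4] -/
@[conjecture] def SpeedFloorAt (k : ℕ) : Prop :=
  ReadoutAt k (fun S v => ∃ x, ‖x‖ ≤ S.radius ∧ S.c₁ * TowerRates.wide.Y (k + 1) ≤ ‖v x‖)

/-- **STRAIN FLOOR AT level `k`** (open; never asserted): every tame continuation of every registered
level-`k` stage carries, at `τ (k+1)`, a velocity gradient of operator norm `≥ c₁ A_{k+1}` at some point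
of the ball. At `k = 1`: strain `≥ A₂ ≈ 5.0·10⁶` somewhere in the ball at `τ₂`. The second conjunct of
`ReadoutFloorsAt k`. [cite: Palasek2026ElementaryModel, §3.1] -/
@[conjecture] def StrainFloorAt (k : ℕ) : Prop :=
  ReadoutAt k (fun S v => ∃ x, ‖x‖ ≤ S.radius ∧ S.c₁ * TowerRates.wide.A (k + 1) ≤ ‖fderiv ℝ v x‖)

/-- **CORE FLOOR AT level `k`** (open; never asserted): every tame continuation of every registered
level-`k` stage carries, at `τ (k+1)`, a level-`(k+1)` core loop — a `C¹` closed curve inside a ball of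
radius `1/N_{k+1}` centred in the tower's ball, of speed `≤ 8π/N_{k+1}`, with circulation
`≥ c₁ N_{k+1}^{β-2}`. At `k = 1`: an `N₂`-core (radius `≈ 1.2·10⁻³`, circulation `≥ N₂^{3/10} ≈ 7.5`) at
`τ₂`. The third (Kelvin-critical, winding-blind) conjunct of `ReadoutFloorsAt k`.
[cite: Palasek2026ElementaryModel, §3.1] -/
@[conjecture] def CoreFloorAt (k : ℕ) : Prop :=
  ReadoutAt k (fun S v => ∃ (x : EuclideanSpace ℝ (Fin 3)) (γ : ℝ → EuclideanSpace ℝ (Fin 3)),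
    ‖x‖ ≤ S.radius ∧ ContDiff ℝ 1 γ ∧ γ 0 = γ 1 ∧
    (∀ σ ∈ Icc (0 : ℝ) 1, γ σ ∈ Metric.closedBall x (1 / TowerRates.wide.N (k + 1))) ∧
    (∀ σ ∈ Icc (0 : ℝ) 1, ‖deriv γ σ‖ ≤ 8 * π / TowerRates.wide.N (k + 1)) ∧
    S.c₁ * TowerRates.wide.N (k + 1) ^ (TowerRates.wide.β - 2) ≤ circulation v γ)

/-- **THE LOWER HALF AT level `k` SPLITS LOSSLESSLY INTO ITS THREE FLOORS**:
`ReadoutFloorsAt k ↔ SpeedFloorAt k ∧ StrainFloorAt k ∧ CoreFloorAt k` (definitional reshuffling of the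
conjunction under the common quantifier prefix; no uniqueness needed). [folklore] -/
theorem readoutFloorsAt_iff_floors {k : ℕ} :
    ReadoutFloorsAt k ↔ SpeedFloorAt k ∧ StrainFloorAt k ∧ CoreFloorAt k := by
  rw [readoutFloorsAt_iff_readoutAt_letter, SpeedFloorAt, StrainFloorAt, CoreFloorAt,
    ← ReadoutAt.and_iff, ← ReadoutAt.and_iff]
  rfl

/-- The lower half at level `k` from its three floors (the composition a sub-line on the stub
`stub_readout_floors_one` registers at `k = 1`). [folklore] -/
theorem readoutFloorsAt_of_floors {k : ℕ} (h₁ : SpeedFloorAt k) (h₂ : StrainFloorAt k)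
    (h₃ : CoreFloorAt k) : ReadoutFloorsAt k :=
  readoutFloorsAt_iff_floors.2 ⟨h₁, h₂, h₃⟩

/-- The lower half yields the speed floor. [folklore] -/
theorem ReadoutFloorsAt.speedFloorAt {k : ℕ} (h : ReadoutFloorsAt k) : SpeedFloorAt k :=
  (readoutFloorsAt_iff_floors.1 h).1

/-- The lower half yields the strain floor. [folklore] -/
theorem ReadoutFloorsAt.strainFloorAt {k : ℕ} (h : ReadoutFloorsAt k) : StrainFloorAt k :=
  (readoutFloorsAt_iff_floors.1 h).2.1

/-- The lower half yields the core floor. [folklore] -/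
theorem ReadoutFloorsAt.coreFloorAt {k : ℕ} (h : ReadoutFloorsAt k) : CoreFloorAt k :=
  (readoutFloorsAt_iff_floors.1 h).2.2

/-- **One good continuation per stage gives the speed floor** (transfer, no W14). [cite: Sohr2001, Ch. V Thm. 1.5.1] -/
theorem SpeedFloorAt.of_exists {k : ℕ}
    (h : ∀ S : Schedule TowerRates.wide, S.Pins 8 (6 / 5) → S.Rigid → S.Quiet →
      ∀ s : Stage 1 TowerRates.wide S (Margins.routeG TowerRates.wide) k,
        ∃ (v : ℝ → EuclideanSpace ℝ (Fin 3) → EuclideanSpace ℝ (Fin 3))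
          (q : ℝ → EuclideanSpace ℝ (Fin 3) → ℝ),
          IsClassicalNSSolutionOn (Icc 0 (S.τ (k + 1))) 1 S.f v q ∧
          (∀ t ∈ Icc 0 (S.τ k), v t = s.u t) ∧
          (∃ C : ℝ≥0∞, C < ⊤ ∧ ∀ t ∈ Icc 0 (S.τ (k + 1)), ∫⁻ x, ‖v t x‖ₑ ^ 2 ≤ C) ∧
          (∀ t ∈ Icc 0 (S.τ (k + 1)), ∀ x, ‖v t x‖ ≤ S.c₂ * TowerRates.wide.Y (k + 1)) ∧
          ∃ x, ‖x‖ ≤ S.radius ∧ S.c₁ * TowerRates.wide.Y (k + 1) ≤ ‖v (S.τ (k + 1)) x‖) :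
    SpeedFloorAt k :=
  ReadoutAt.of_exists h

/-- **One good continuation per stage gives the strain floor** (transfer, no W14). [cite: Sohr2001, Ch. V Thm. 1.5.1] -/
theorem StrainFloorAt.of_exists {k : ℕ}
    (h : ∀ S : Schedule TowerRates.wide, S.Pins 8 (6 / 5) → S.Rigid → S.Quiet →
      ∀ s : Stage 1 TowerRates.wide S (Margins.routeG TowerRates.wide) k,
        ∃ (v : ℝ → EuclideanSpace ℝ (Fin 3) → EuclideanSpace ℝ (Fin 3))
          (q : ℝ → EuclideanSpace ℝ (Fin 3) → ℝ),
          IsClassicalNSSolutionOn (Icc 0 (S.τ (k + 1))) 1 S.f v q ∧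
          (∀ t ∈ Icc 0 (S.τ k), v t = s.u t) ∧
          (∃ C : ℝ≥0∞, C < ⊤ ∧ ∀ t ∈ Icc 0 (S.τ (k + 1)), ∫⁻ x, ‖v t x‖ₑ ^ 2 ≤ C) ∧
          (∀ t ∈ Icc 0 (S.τ (k + 1)), ∀ x, ‖v t x‖ ≤ S.c₂ * TowerRates.wide.Y (k + 1)) ∧
          ∃ x, ‖x‖ ≤ S.radius ∧ S.c₁ * TowerRates.wide.A (k + 1) ≤ ‖fderiv ℝ (v (S.τ (k + 1))) x‖) :
    StrainFloorAt k :=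
  ReadoutAt.of_exists h

/-- **One good continuation per stage gives the core floor** (transfer, no W14). [cite: Sohr2001, Ch. V Thm. 1.5.1] -/
theorem CoreFloorAt.of_exists {k : ℕ}
    (h : ∀ S : Schedule TowerRates.wide, S.Pins 8 (6 / 5) → S.Rigid → S.Quiet →
      ∀ s : Stage 1 TowerRates.wide S (Margins.routeG TowerRates.wide) k,
        ∃ (v : ℝ → EuclideanSpace ℝ (Fin 3) → EuclideanSpace ℝ (Fin 3))
          (q : ℝ → EuclideanSpace ℝ (Fin 3) → ℝ),
          IsClassicalNSSolutionOn (Icc 0 (S.τ (k + 1))) 1 S.f v q ∧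
          (∀ t ∈ Icc 0 (S.τ k), v t = s.u t) ∧
          (∃ C : ℝ≥0∞, C < ⊤ ∧ ∀ t ∈ Icc 0 (S.τ (k + 1)), ∫⁻ x, ‖v t x‖ₑ ^ 2 ≤ C) ∧
          (∀ t ∈ Icc 0 (S.τ (k + 1)), ∀ x, ‖v t x‖ ≤ S.c₂ * TowerRates.wide.Y (k + 1)) ∧
          ∃ (x : EuclideanSpace ℝ (Fin 3)) (γ : ℝ → EuclideanSpace ℝ (Fin 3)),
            ‖x‖ ≤ S.radius ∧ ContDiff ℝ 1 γ ∧ γ 0 = γ 1 ∧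
            (∀ σ ∈ Icc (0 : ℝ) 1, γ σ ∈ Metric.closedBall x (1 / TowerRates.wide.N (k + 1))) ∧
            (∀ σ ∈ Icc (0 : ℝ) 1, ‖deriv γ σ‖ ≤ 8 * π / TowerRates.wide.N (k + 1)) ∧
            S.c₁ * TowerRates.wide.N (k + 1) ^ (TowerRates.wide.β - 2) ≤
              circulation (v (S.τ (k + 1))) γ) :
    CoreFloorAt k :=
  ReadoutAt.of_exists h

/-! ## §3 Heredity at level `k ≥ 1`, and item 19249, in four physics conjuncts -/

/-- **Heredity at level `k ≥ 1` ⇔ no overshoot ∧ the three floors of level `k + 1`**, no hypothesis: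
`HeredityAt k ↔ AprioriCeilingAt k ∧ SpeedFloorAt k ∧ StrainFloorAt k ∧ CoreFloorAt k`.
[cite: Palasek2026ElementaryModel, §4] -/
theorem heredityAt_iff_apriori_and_floors {k : ℕ} (hk : 1 ≤ k) :
    HeredityAt k ↔ AprioriCeilingAt k ∧ SpeedFloorAt k ∧ StrainFloorAt k ∧ CoreFloorAt k := by
  rw [heredityAt_iff_aprioriCeilingAt_and_readoutFloorsAt hk, readoutFloorsAt_iff_floors]

/-- **ITEM 19249 IN FOUR PHYSICS CONJUNCTS, no hypothesis**:
`HeredityAtOne ↔ AprioriCeilingAt 1 ∧ SpeedFloorAt 1 ∧ StrainFloorAt 1 ∧ CoreFloorAt 1` — the hand-over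
`1 → 2` holds iff no finite-energy classical continuation of a registered level-1 stage exceeds `(5/3)·Y₂`
before `τ₂` while it exists, and every such continuation to `τ₂` inside the ceiling shows at `τ₂`, in
the ball, (i) speed `≥ Y₂`, (ii) strain `≥ A₂`, (iii) an `N₂`-core. [cite: Palasek2026ElementaryModel, §4] -/
theorem heredityAtOne_iff_apriori_speed_strain_core :
    HeredityAtOne ↔ AprioriCeilingAt 1 ∧ SpeedFloorAt 1 ∧ StrainFloorAt 1 ∧ CoreFloorAt 1 :=
  heredityAtOne_iff.trans (heredityAt_iff_apriori_and_floors le_rfl)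

/-- Item 19249 from its four physics conjuncts. [cite: Palasek2026ElementaryModel, §4] -/
theorem heredityAtOne_of_apriori_floors (hA : AprioriCeilingAt 1) (h₁ : SpeedFloorAt 1)
    (h₂ : StrainFloorAt 1) (h₃ : CoreFloorAt 1) : HeredityAtOne :=
  heredityAtOne_iff_apriori_speed_strain_core.2 ⟨hA, h₁, h₂, h₃⟩

/-- Heredity at level `k` yields the speed floor at level `k` (no W14). [cite: Sohr2001, Ch. V Thm. 1.5.1] -/
theorem HeredityAt.speedFloorAt {k : ℕ} (h : HeredityAt k) : SpeedFloorAt k :=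
  h.readoutFloorsAt.speedFloorAt

/-- Heredity at level `k` yields the strain floor at level `k` (no W14). [cite: Sohr2001, Ch. V Thm. 1.5.1] -/
theorem HeredityAt.strainFloorAt {k : ℕ} (h : HeredityAt k) : StrainFloorAt k :=
  h.readoutFloorsAt.strainFloorAt

/-- Heredity at level `k` yields the core floor at level `k` (no W14). [cite: Sohr2001, Ch. V Thm. 1.5.1] -/
theorem HeredityAt.coreFloorAt {k : ℕ} (h : HeredityAt k) : CoreFloorAt k :=
  h.readoutFloorsAt.coreFloorAt

/-- The first rung yields the level-2 speed floor. [cite: Sohr2001, Ch. V Thm. 1.5.1] -/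
theorem HeredityAtOne.speedFloorAt_one (h : HeredityAtOne) : SpeedFloorAt 1 :=
  (heredityAtOne_iff.1 h).speedFloorAt

/-- The first rung yields the level-2 strain floor. [cite: Sohr2001, Ch. V Thm. 1.5.1] -/
theorem HeredityAtOne.strainFloorAt_one (h : HeredityAtOne) : StrainFloorAt 1 :=
  (heredityAtOne_iff.1 h).strainFloorAt

/-- The first rung yields the level-2 core floor. [cite: Sohr2001, Ch. V Thm. 1.5.1] -/
theorem HeredityAtOne.coreFloorAt_one (h : HeredityAtOne) : CoreFloorAt 1 :=
  (heredityAtOne_iff.1 h).coreFloorAt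

/-- The lower half of record (`ReadoutFloors`, levels `k ≥ 2`, item 19250's lower stub) in three floors
per level: `ReadoutFloors ↔ ∀ k ≥ 2, SpeedFloorAt k ∧ StrainFloorAt k ∧ CoreFloorAt k`. [folklore] -/
theorem readoutFloors_iff_forall_floors :
    ReadoutFloors ↔ ∀ k : ℕ, 2 ≤ k → SpeedFloorAt k ∧ StrainFloorAt k ∧ CoreFloorAt k := by
  rw [readoutFloors_iff_forall_at]
  exact forall_congr' fun k => forall_congr' fun _ => readoutFloorsAt_iff_floors

/-! ## §4 What the core conjunct already pays toward the other two -/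

/-- **The core floor carries WEAK speed and strain floors**: `CoreFloorAt k` gives, on every tame
continuation of every registered level-`k` stage, a point within `radius + 1/N_{k+1}` of speed
`≥ c₁ Y_{k+1} / (8π)` and one of strain `≥ c₁ A_{k+1} / (8π)` at `τ (k+1)` (Stokes-free kinematics of a
short loop, ecbridge-5's `readout_core_floors`). The registered conjuncts `SpeedFloorAt k` /
`StrainFloorAt k` ask the factor `8π ≈ 25.1` more, inside the ball proper. [cite: MajdaBertozziCUP2002, §1.6] -/
theorem CoreFloorAt.weak_floors {k : ℕ} (h : CoreFloorAt k) :
    ReadoutAt k (fun S v =>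
      (∃ y, ‖y‖ ≤ S.radius + 1 / TowerRates.wide.N (k + 1) ∧
        S.c₁ * TowerRates.wide.Y (k + 1) / (8 * π) ≤ ‖v y‖) ∧
      (∃ y, ‖y‖ ≤ S.radius + 1 / TowerRates.wide.N (k + 1) ∧
        S.c₁ * TowerRates.wide.A (k + 1) / (8 * π) ≤ ‖fderiv ℝ v y‖)) := by
  intro S hP hR hQ s u p hcl hagree hE hceil
  exact readout_core_floors hcl (h S hP hR hQ s u p hcl hagree hE hceil)

/-! ## §5 Arithmetic of the first hand-over: the speed floor is a genuine jump -/

/-- **The level-2 speed floor is incompatible with the level-1 ceiling** (certified, wide rates):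
`(5/3)·Y₁ < Y₂` (`Y₁ < 2779`, `6139 < Y₂`; indeed `Y₂ > 2.209·Y₁ > 1.325·(5/3)Y₁`). [folklore] -/
theorem speedFloor_two_gt_ceiling_one : 5 / 3 * TowerRates.wide.Y 1 < TowerRates.wide.Y 2 := by
  have h1 := TowerRates.wide_Y_one_bounds.2
  have h2 := TowerRates.wide_Y_two_bounds.1
  linarith

/-- The growth factors the first hand-over demands of the speed maximum (certified): from the level-1
CEILING, `Y₂ / ((5/3)·Y₁) > 1.325`; from the level-1 FLOOR point, `Y₂ / Y₁ > 2.209`. [folklore] -/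
theorem speedFloor_two_growth_factors :
    (1.325 : ℝ) * (5 / 3 * TowerRates.wide.Y 1) < TowerRates.wide.Y 2 ∧
      (2.209 : ℝ) * TowerRates.wide.Y 1 < TowerRates.wide.Y 2 := by
  have h1 := TowerRates.wide_Y_one_bounds.2
  have h2 := TowerRates.wide_Y_two_bounds.1
  constructor <;> nlinarith

/-- **`SpeedFloorAt 1` is a JUMP produced inside the window `(τ₁, τ₂]`, never inherited**: on a rigid
schedule (`c₁ = 1`, `c₂ = 5/3`) every tame continuation `u` of a registered level-1 stage `s` obeys
`‖u(τ₁, y)‖ ≤ (5/3)·Y₁ < Y₂` everywhere (the stage's own level-1 ceiling, by agreement at `τ₁`), so the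
speed floor gives a point `x` of the ball with `‖u(τ₂, x)‖ ≥ Y₂ > ‖u(τ₁, y)‖` for EVERY `y ∈ ℝ³`.
[cite: Palasek2026ElementaryModel, §4] -/
theorem SpeedFloorAt.exists_jump_one (h : SpeedFloorAt 1) :
    ReadoutAt 1 (fun S v => ∃ x, ‖x‖ ≤ S.radius ∧ TowerRates.wide.Y 2 ≤ ‖v x‖ ∧
      5 / 3 * TowerRates.wide.Y 1 < ‖v x‖) := by
  intro S hP hR hQ s u p hcl hagree hE hceil
  obtain ⟨x, hx, hfl⟩ := h S hP hR hQ s u p hcl hagree hE hceil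
  rw [hR.c₁_eq, one_mul] at hfl
  exact ⟨x, hx, hfl, lt_of_lt_of_le speedFloor_two_gt_ceiling_one hfl⟩

/-- The same jump read against the stage: under `SpeedFloorAt 1`, for every tame continuation `u` of a
registered level-1 stage `s` of a pinned rigid quiet wide design there is a point `x` of the ball with
`‖s.u(τ₁, y)‖ < ‖u(τ₂, x)‖` for all `y` (the level-1 flow's speed ANYWHERE at `τ₁` is exceeded in the ball
at `τ₂`). [cite: Palasek2026ElementaryModel, §4] -/
theorem SpeedFloorAt.exists_exceeds_stage_one (h : SpeedFloorAt 1) :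
    ∀ S : Schedule TowerRates.wide, S.Pins 8 (6 / 5) → S.Rigid → S.Quiet →
      ∀ s : Stage 1 TowerRates.wide S (Margins.routeG TowerRates.wide) 1,
      ∀ (u : ℝ → EuclideanSpace ℝ (Fin 3) → EuclideanSpace ℝ (Fin 3))
        (p : ℝ → EuclideanSpace ℝ (Fin 3) → ℝ),
        IsClassicalNSSolutionOn (Icc 0 (S.τ 2)) 1 S.f u p →
        (∀ t ∈ Icc 0 (S.τ 1), u t = s.u t ∧ p t = s.p t) →
        (∃ C : ℝ≥0∞, C < ⊤ ∧ ∀ t ∈ Icc 0 (S.τ 2), ∫⁻ x, ‖u t x‖ₑ ^ 2 ≤ C) →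
        (∀ t ∈ Icc 0 (S.τ 2), ∀ x, ‖u t x‖ ≤ S.c₂ * TowerRates.wide.Y 2) →
        ∃ x, ‖x‖ ≤ S.radius ∧ ∀ y, ‖s.u (S.τ 1) y‖ < ‖u (S.τ 2) x‖ := by
  intro S hP hR hQ s u p hcl hagree hE hceil
  obtain ⟨x, hx, -, hjump⟩ := h.exists_jump_one S hP hR hQ s u p hcl hagree hE hceil
  refine ⟨x, hx, fun y => lt_of_le_of_lt ?_ hjump⟩
  have hc := s.ceiling 1 le_rfl (S.τ 1) ⟨(S.τ_pos 1).le, le_rfl⟩ y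
  rw [hR.c₂_eq] at hc
  exact hc

end Summit.NavierStokesRegularity.FluidComputer.PalasekTowerClayBridge

end
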